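import Mathlib
import Literature.NumberTheory.GaloisRepresentations.WeilDeligneRep
import Literature.NumberTheory.Automorphic.LParameter
import Literature.NumberTheory.GaloisRepresentations.LocalGaloisGroupProofs
import Literature.NumberTheory.GaloisRepresentations.LocalGaloisGroupFrobeniusProofs

/-!
# Unramified scalar twists of Weil–Deligne representations (tool file)

Solo seat `solo-Langlands-informed`, session 48; the algebra behind
`SoloInformedPstSpecTwist` ("the specification `IsFontaineDatum` does not determine `WD ∘ D_pst`").

For a unit `c` of the coefficient field and a Weil–Deligne representation `r = (ρ, N)` of `W_F`,
`scalarTwist c r := (w ↦ c ^ deg w • ρ(w), N)` is the twist by the unramified character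
`w ↦ c ^ deg w` (`deg` = the degree map of the Weil group, zero exactly on inertia; the tree theorems
`IsFrobPow.mul_holds` / `IsFrobPow.unique_holds` discharge the hypotheses of `WeilGroup.deg`).  Proved:

* it is again a Weil–Deligne representation, functorial in isomorphisms (`isEquivalent_scalarTwist`);
* it preserves and reflects "`N = 0` and inertia acts trivially" (`scalarTwist_unram_iff`), and
  isomorphisms transport that property (`unram_of_isEquivalent`);
* **separation** (`not_isEquivalent_scalarTwist`): if `c ^ dim V ≠ 1` then `r ≇ scalarTwist c r` —
  take determinants of the intertwining identity at a Weil element of degree `1`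
  (`exists_isFrobPow_holds`).

Elementary; no citation is load-bearing.
-/

noncomputable section

open Literature.NumberTheory.GaloisRepresentations

namespace Summit.Langlands.Langlands.Theorems

namespace PstSpecTwist

/-! ### Unramified scalar twists of Weil–Deligne representations -/

section WD

variable {F : Type} [Field F] [ValuativeRel F] [TopologicalSpace F] [IsNonarchimedeanLocalField F]
  {C : Type*} [Field C] [CharZero C]
  {V : Type*} [AddCommGroup V] [Module C V] {V' : Type*} [AddCommGroup V'] [Module C V']
  {V'' : Type*} [AddCommGroup V''] [Module C V'']

/-- **The unramified scalar twist** `(w ↦ c ^ deg w • r(w), N)` of a Weil–Deligne representation by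
the unramified character `w ↦ c ^ deg w` (`deg` = the degree map of the Weil group, `deg = 0` on
inertia). -/
def scalarTwist (c : Cˣ) (r : WeilDeligneRep F C V) : WeilDeligneRep F C V where
  ρ :=
    { toFun := fun w => ((c : C) ^ (WeilGroup.deg w)) • r.ρ w
      map_one' := by
        rw [map_one, WeilGroup.deg_one IsFrobPow.mul_holds IsFrobPow.unique_holds, zpow_zero, one_smul]
      map_mul' := fun w w' => by
        rw [WeilGroup.deg_mul IsFrobPow.mul_holds IsFrobPow.unique_holds, zpow_add₀ c.ne_zero, map_mul, smul_mul_smul_comm] }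
  isContinuous := by
    obtain ⟨U, hU, hUo, hρ⟩ := r.isContinuous
    refine ⟨U, hU, hUo, fun u hu => ?_⟩
    simp only [MonoidHom.coe_mk, OneHom.coe_mk, hρ u hu]
    rw [(WeilGroup.deg_eq_zero_iff_mem_inertia IsFrobPow.mul_holds IsFrobPow.unique_holds).mpr (hU hu), zpow_zero, one_smul]
  N := r.N
  isNilpotent_N := r.isNilpotent_N
  conj_N w := by
    simp only [MonoidHom.coe_mk, OneHom.coe_mk, LinearMap.smul_comp, LinearMap.comp_smul,
      r.conj_N w]
    rw [smul_comm]

/-- The twist does not change the monodromy operator. -/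
@[simp] theorem scalarTwist_N (c : Cˣ) (r : WeilDeligneRep F C V) : (scalarTwist c r).N = r.N := rfl

/-- Values of the twisted representation of the Weil group. -/
@[simp] theorem scalarTwist_ρ_apply (c : Cˣ) (r : WeilDeligneRep F C V) (w : WeilGroup F) :
    (scalarTwist c r).ρ w = ((c : C) ^ (WeilGroup.deg w)) • r.ρ w := rfl

/-- The twist is functorial in isomorphisms: `r ≅ r' ⇒ r ⊗ c^deg ≅ r' ⊗ c^deg` (same linear map). -/
theorem isEquivalent_scalarTwist {r : WeilDeligneRep F C V} {r' : WeilDeligneRep F C V'}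
    (h : r.IsEquivalent r') (c : Cˣ) : (scalarTwist c r).IsEquivalent (scalarTwist c r') := by
  obtain ⟨e⟩ := h
  refine ⟨{ toRepEquiv := Representation.Equiv.mk e.toLinearEquiv fun w => ?_, comm_N := ?_ }⟩
  · refine LinearMap.ext fun v => ?_
    have h := congr($(e.isIntertwining' w) v)
    simp only [LinearMap.coe_comp, Function.comp_apply] at h
    simp only [LinearMap.coe_comp, Function.comp_apply, scalarTwist_ρ_apply, LinearMap.smul_apply,
      map_smul]
    rw [h]
  · refine LinearMap.ext fun v => ?_
    have h := congr($(e.comm_N) v)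
    simp only [LinearMap.coe_comp, Function.comp_apply] at h
    exact h

/-- An isomorphism transports "`N = 0` and inertia acts trivially". -/
theorem unram_of_isEquivalent {r : WeilDeligneRep F C V} {r' : WeilDeligneRep F C V'}
    (h : r.IsEquivalent r') (h0 : r.N = 0 ∧ WeilGroup.IsUnramifiedRep r.ρ) :
    r'.N = 0 ∧ WeilGroup.IsUnramifiedRep r'.ρ := by
  obtain ⟨e⟩ := h
  have hsurj : Function.Surjective e.toLinearEquiv := e.toLinearEquiv.surjective
  refine ⟨LinearMap.ext fun w => ?_, fun u hu => LinearMap.ext fun w => ?_⟩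
  · obtain ⟨v, rfl⟩ := hsurj w
    have h := congr($(e.comm_N) v)
    simp only [LinearMap.coe_comp, Function.comp_apply, h0.1, LinearMap.zero_apply, map_zero] at h
    rw [LinearMap.zero_apply]
    exact h.symm
  · obtain ⟨v, rfl⟩ := hsurj w
    have h := congr($(e.isIntertwining' u) v)
    simp only [LinearMap.coe_comp, Function.comp_apply, h0.2 u hu, Module.End.one_apply] at h
    rw [Module.End.one_apply]
    exact h.symm

/-- The twist by `c ^ deg` preserves and reflects "`N = 0` and inertia acts trivially"
(`deg = 0` on inertia). -/
theorem scalarTwist_unram_iff (c : Cˣ) (r : WeilDeligneRep F C V) :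
    ((scalarTwist c r).N = 0 ∧ WeilGroup.IsUnramifiedRep (scalarTwist c r).ρ) ↔
      (r.N = 0 ∧ WeilGroup.IsUnramifiedRep r.ρ) := by
  refine and_congr Iff.rfl ⟨fun h u hu => ?_, fun h u hu => ?_⟩
  · have h1 := h u hu
    rw [scalarTwist_ρ_apply, (WeilGroup.deg_eq_zero_iff_mem_inertia IsFrobPow.mul_holds IsFrobPow.unique_holds).mpr hu, zpow_zero,
      one_smul] at h1
    exact h1
  · rw [scalarTwist_ρ_apply, (WeilGroup.deg_eq_zero_iff_mem_inertia IsFrobPow.mul_holds IsFrobPow.unique_holds).mpr hu, zpow_zero,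
      one_smul]
    exact h u hu

/-- **Separation**: if `c ^ dim V ≠ 1`, no Weil–Deligne representation on `V` is isomorphic to its own
twist by `c ^ deg` — compare determinants at a Weil element of degree `1`
(`exists_isFrobPow_holds`). -/
theorem not_isEquivalent_scalarTwist [FiniteDimensional C V] (r : WeilDeligneRep F C V) (c : Cˣ)
    (hc : (c : C) ^ (Module.finrank C V) ≠ 1) : ¬ r.IsEquivalent (scalarTwist c r) := by
  rintro ⟨e⟩
  obtain ⟨σ, hσ⟩ := exists_isFrobPow_holds (F := F) 1
  set w : WeilGroup F := WeilGroup.mk σ ⟨1, hσ⟩ with hw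
  have hdeg : WeilGroup.deg w = 1 :=
    (WeilGroup.deg_eq_iff IsFrobPow.mul_holds IsFrobPow.unique_holds).mpr (by rw [hw, WeilGroup.toAbsGalois_mk]; exact hσ)
  have h := congrArg LinearMap.det (e.isIntertwining' w)
  rw [scalarTwist_ρ_apply, hdeg, zpow_one, LinearMap.smul_comp, LinearMap.det_smul,
    LinearMap.det_comp, LinearMap.det_comp] at h
  have he : IsUnit (LinearMap.det (e.toLinearEquiv : V →ₗ[C] V)) :=
    LinearMap.isUnit_det _ ((Module.End.isUnit_iff _).mpr e.toLinearEquiv.bijective)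
  have hρ : IsUnit (LinearMap.det (r.ρ w)) := LinearMap.isUnit_det _ ((Group.isUnit w).map r.ρ)
  have hu : LinearMap.det (e.toLinearEquiv : V →ₗ[C] V) * LinearMap.det (r.ρ w) ≠ 0 :=
    (he.mul hρ).ne_zero
  apply hc
  refine mul_right_cancel₀ hu ?_
  rw [one_mul]
  linear_combination (-1 : C) * h

end WD

end PstSpecTwist

end Summit.Langlands.Langlands.Theorems

end
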